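import Summits.QuantumFields.YangMills.Theorems.UnitScaleTiltProp8ChartDiff
import Summits.QuantumFields.YangMills.Theorems.UnitScaleTiltProp8ChartTransport
import HarnessLib

/-!
# Route `UnitScaleTilt`, crux K1 «MinimiserStabilityRegPr» (stmt-QuantumFields-19200), leaf V2′ `stub_halvingStep` — pillar P3 `ChartPerLevel`:
# **LOCAL DIFFERENTIABILITY OF THE UNGUARDED (0.4) AVERAGE AND OF THE CHART AT A GENERAL BASE POINT** (the qualitative half of hCd of `ChartRemainderAt`
# off the flat point: only the READ bonds need to be differentiable and near-flat)

Cell `ym3-torus` ∕ fleet seat `ym-ust-19200-p2` g6 (v8 PEN).  p540989 (`…Prop8ChartDiff`) proves differentiability of `chartLog η D` AT THE FLAT POINT, through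
`differentiableAt_coe_emlAvgU`, whose hypothesis asks EVERY bond variable of the family to be differentiable.  Off the flat point, on the weighted ball of the
P3 text, far-away bond variables of the iterated averages are NOT near `1` (fine territories carry deviations `R·L^{−j′}/η`), so the global hypothesis is
unavailable; but `Ū(c)` only reads the two-block bonds of `c` (p546323 `emlAvgU_congr₂`).  This file localises the calculus accordingly:
* §1 `differentiableAt_coe_holT_of_steps` — a transport is differentiable in the parameter as soon as the bond variables ON ITS WALK are;
* §2 **`differentiableAt_coe_emlAvgU_of_twoBlock`** — `x ↦ (emlAvgU (F x))(c)` is differentiable at `x₀` as soon as the two-block bond variables of `c` are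
  differentiable at `x₀` and the loop variables of `F x₀` at `c` are within `1` of `1`; `norm_loopHolU_sub_one_lt_one` — the latter holds when the two-block
  bond variables of `F x₀` are within `s` of `1`, `4ℓs < 1` (p548268 `norm_loopHolU_sub_one_le`);
* §3 **`differentiableAt_chartLog_apply_of`** — `A ↦ chartLog η D A (j, c)` is differentiable at `A₀` as soon as `A ↦ Ū^{(j)}(e^{iηA})(c)` is and
  `‖Ū^{(j)}(e^{iηA₀})(c) − 1‖ < 1`; **`differentiableOn_chartLog_of_forall`** — pointwise-to-`DifferentiableOn` assembly over the index set.
The QUANTITATIVE input (k-uniform near-flatness of the iterated averages on the read regions) is the factorised engine (p548486 `…OneStep`, `…IterSmall`);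
this file is its calculus companion.  Sorry-free, definition-free.  NOT a claim about the mass gap.

References: T. Bałaban, CMP **109** (1987) 249–301 [Balaban1987RG1] ((0.4) p.253 «Gᶜ-valued … analytic»); CMP **102** (1985) 277–309 [Balaban1985Variational]
((47)–(48) p.285, (156) p.302).
-/

noncomputable section

open scoped BigOperators
open NormedSpace

namespace Summit.QuantumFields.YangMills.Theorems.Prop8Chart

open Literature.MathematicalPhysics.QuantumFieldTheory.Balaban1983to89
open T4Continuum BlockAveraging AveragingRT ExpMeanLog MatrixLog BlockAveragingEMLLinearised
open B10Eq27TorusAxialLog (holT holT_nil holT_cons_true holT_cons_false)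
open B6SectADomainsV1 (Domains)
open B6SectAOperatorsV1 (BondIdx)

variable {P : Params} {j : ℕ}
variable {𝔸 : Type*} [NormedRing 𝔸] [NormedAlgebra ℂ 𝔸] [CompleteSpace 𝔸]
variable {E : Type*} [NormedAddCommGroup E] [NormedSpace ℂ E]

/-! ## §1 Transports: only the bonds on the walk -/

/-- **A TRANSPORT IS DIFFERENTIABLE IN THE PARAMETER AS SOON AS THE BOND VARIABLES ON ITS WALK ARE.** [cite: Balaban1985Averaging, (9) p.18] -/
theorem differentiableAt_coe_holT_of_steps {F : E → GaugeField P j 𝔸ˣ} {x₀ : E} :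
    ∀ (w : List (Letter P.d)) (y : Site P j),
      (∀ st ∈ walk y w, DifferentiableAt ℂ (fun x => ((F x st.bond : 𝔸ˣ) : 𝔸)) x₀) →
      DifferentiableAt ℂ (fun x => ((holT (F x) y w : 𝔸ˣ) : 𝔸)) x₀
  | [], y, _ => by simp [holT_nil]
  | (μ, true) :: w, y, h => by
    have ih := differentiableAt_coe_holT_of_steps w (y.shift μ) fun st hst => h st (by simp [walk, hst])
    have hb := h ⟨⟨y, μ⟩, true⟩ (by simp [walk])
    have hfun : (fun x => ((holT (F x) y ((μ, true) :: w) : 𝔸ˣ) : 𝔸)) =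
        fun x => ((F x ⟨y, μ⟩ : 𝔸ˣ) : 𝔸) * ((holT (F x) (y.shift μ) w : 𝔸ˣ) : 𝔸) := by
      funext x; rw [holT_cons_true, Units.val_mul]
    rw [hfun]
    exact hb.mul ih
  | (μ, false) :: w, y, h => by
    have ih := differentiableAt_coe_holT_of_steps w (y.unshift μ) fun st hst => h st (by simp [walk, hst])
    have hb := h ⟨⟨y.unshift μ, μ⟩, false⟩ (by simp [walk])
    have hfun : (fun x => ((holT (F x) y ((μ, false) :: w) : 𝔸ˣ) : 𝔸)) =
        fun x => (((F x ⟨y.unshift μ, μ⟩)⁻¹ : 𝔸ˣ) : 𝔸) * ((holT (F x) (y.unshift μ) w : 𝔸ˣ) : 𝔸) := by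
      funext x; rw [holT_cons_false, Units.val_mul]
    rw [hfun]
    exact (differentiableAt_coe_inv hb).mul ih

/-! ## §2 The unguarded average: only the two-block bonds -/

/-- **LOCAL DIFFERENTIABILITY OF THE UNGUARDED (0.4) AVERAGE**: if the bond variables of `F x` on the two-block bonds of `c` (both ends in `B(c₋) ∪ B(c₊)`) are
differentiable at `x₀` and the loop variables of `F x₀` at `c` are within `1` of `1`, then `x ↦ (emlAvgU (F x))(c)` is differentiable at `x₀`.
[cite: Balaban1987RG1, (0.4) p.253] -/
theorem differentiableAt_coe_emlAvgU_of_twoBlock (hj : j + 1 ≤ P.m + P.K) {F : E → GaugeField P j 𝔸ˣ} {x₀ : E} (c : PBond P (j + 1))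
    (hF : ∀ b : PBond P j, (blockOf b.src = c.src ∨ blockOf b.src = c.tgt) → (blockOf b.tgt = c.src ∨ blockOf b.tgt = c.tgt) →
      DifferentiableAt ℂ (fun x => ((F x b : 𝔸ˣ) : 𝔸)) x₀)
    (hloop : ∀ i : Idx P, ‖((loopHolU (F x₀) c i : 𝔸ˣ) : 𝔸) - 1‖ < 1) :
    DifferentiableAt ℂ (fun x => ((emlAvgU (F x) c : 𝔸ˣ) : 𝔸)) x₀ := by
  have h : (fun x => ((emlAvgU (F x) c : 𝔸ˣ) : 𝔸)) = fun x =>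
      eml (fun i : Idx P => ((loopHolU (F x) c i : 𝔸ˣ) : 𝔸)) * ((holT (F x) (emb c.src) (List.replicate P.L (c.dir, true)) : 𝔸ˣ) : 𝔸) := by
    funext x; exact coe_emlAvgU (F x) c
  rw [h]
  refine DifferentiableAt.mul ?_ (differentiableAt_coe_holT_of_steps _ _ fun st hst => ?_)
  · have hfam : DifferentiableAt ℂ (fun x => fun i : Idx P => ((loopHolU (F x) c i : 𝔸ˣ) : 𝔸)) x₀ :=
      differentiableAt_pi.mpr fun i => by
        unfold loopHolU
        exact differentiableAt_coe_holT_of_steps _ _ fun st hst =>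
          hF st.bond (two_block_of_mem_loopWalk hj c i hst).1 (two_block_of_mem_loopWalk hj c i hst).2
    exact (differentiableAt_eml hloop).comp x₀ hfam
  · obtain ⟨t, ht, hb⟩ := exists_eq_line_of_mem_walk c hst
    rw [hb]
    exact hF (line c t) (blockOf_lineSite hj c ht) (T4ReflectionConeSharp.blockOf_tgt_line hj c ht)

omit [NormedAlgebra ℂ 𝔸] [CompleteSpace 𝔸] in
/-- The loop variables of a field within `s` of `1` on the two-block bonds of `c`, `4ℓs < 1`, are within `1` of `1`. [cite: Balaban1987RG1, (0.4) p.253] -/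
theorem norm_loopHolU_sub_one_lt_one [NormOneClass 𝔸] (hj : j + 1 ≤ P.m + P.K) {S : GaugeField P j 𝔸ˣ} (c : PBond P (j + 1)) {s : ℝ} (hs0 : 0 ≤ s)
    (hℓs : 4 * (((P.d + 2) * P.L : ℕ) : ℝ) * s < 1)
    (hS : ∀ b : PBond P j, (blockOf b.src = c.src ∨ blockOf b.src = c.tgt) → (blockOf b.tgt = c.src ∨ blockOf b.tgt = c.tgt) →
      ‖((S b : 𝔸ˣ) : 𝔸) - 1‖ ≤ s) (i : Idx P) :
    ‖((loopHolU S c i : 𝔸ˣ) : 𝔸) - 1‖ < 1 :=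
  ((norm_loopHolU_sub_one_le hj c hs0 hℓs.le hS i).1).trans_lt hℓs

/-! ## §3 The chart at a general base point -/

/-- **`A ↦ chartLog η D A (j, c)` IS DIFFERENTIABLE AT `A₀` AS SOON AS `A ↦ Ū^{(j)}(e^{iηA})(c)` IS AND `‖Ū^{(j)}(e^{iηA₀})(c) − 1‖ < 1`** (the logarithm is
analytic there). [cite: Balaban1985Variational, (156) p.302; Balaban1987RG1, (0.4) p.253] -/
theorem differentiableAt_chartLog_apply_of (η : ℝ) (D : Domains P) (idx : BondIdx D) {A₀ : PBond P 0 → 𝔸}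
    (hdiff : DifferentiableAt ℂ (fun A : PBond P 0 → 𝔸 => ((emlIterU (idx.1.1 : ℕ) (expCfg η A) idx.1.2 : 𝔸ˣ) : 𝔸)) A₀)
    (hnear : ‖((emlIterU (idx.1.1 : ℕ) (expCfg η A₀) idx.1.2 : 𝔸ˣ) : 𝔸) - 1‖ < 1) :
    DifferentiableAt ℂ (fun A : PBond P 0 → 𝔸 => chartLog η D A idx) A₀ := by
  have hfun : (fun A : PBond P 0 → 𝔸 => chartLog η D A idx) =
      fun A => (-Complex.I) • mlog (((emlIterU (idx.1.1 : ℕ) (expCfg η A)) idx.1.2 : 𝔸ˣ) : 𝔸) := rfl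
  rw [hfun]
  exact ((MatrixLog.analyticAt_mlog hnear).differentiableAt.comp A₀ hdiff).const_smul (-Complex.I)

/-- The same for the tree-normalised `chartQ`. [cite: Balaban1985Variational, (156) p.302] -/
theorem differentiableAt_chartQ_apply_of (η : ℝ) (D : Domains P) (idx : BondIdx D) {A₀ : PBond P 0 → 𝔸}
    (hdiff : DifferentiableAt ℂ (fun A : PBond P 0 → 𝔸 => ((emlIterU (idx.1.1 : ℕ) (expCfg η A) idx.1.2 : 𝔸ˣ) : 𝔸)) A₀)
    (hnear : ‖((emlIterU (idx.1.1 : ℕ) (expCfg η A₀) idx.1.2 : 𝔸ˣ) : 𝔸) - 1‖ < 1) :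
    DifferentiableAt ℂ (fun A : PBond P 0 → 𝔸 => chartQ η D A idx) A₀ := by
  have hfun : (fun A : PBond P 0 → 𝔸 => chartQ η D A idx) =
      fun A => ((Complex.I * (η : ℂ) * ((P.L : ℂ) ^ (idx.1.1 : ℕ)))⁻¹) • mlog (((emlIterU (idx.1.1 : ℕ) (expCfg η A)) idx.1.2 : 𝔸ˣ) : 𝔸) := rfl
  rw [hfun]
  exact ((MatrixLog.analyticAt_mlog hnear).differentiableAt.comp A₀ hdiff).const_smul
    ((Complex.I * (η : ℂ) * ((P.L : ℂ) ^ (idx.1.1 : ℕ)))⁻¹ : ℂ)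

/-- **POINTWISE-TO-`DifferentiableOn` ASSEMBLY**: if at every point of a set every index component of `chartLog η D` is differentiable, then `chartLog η D` is
differentiable on the set. [folklore] -/
theorem differentiableOn_chartLog_of_forall (η : ℝ) (D : Domains P) {O : Set (PBond P 0 → 𝔸)}
    (h : ∀ A₀ ∈ O, ∀ idx : BondIdx D, DifferentiableAt ℂ (fun A : PBond P 0 → 𝔸 => chartLog η D A idx) A₀) :
    DifferentiableOn ℂ (chartLog η D : (PBond P 0 → 𝔸) → BondIdx D → 𝔸) O :=
  fun A₀ hA₀ => (differentiableAt_pi.mpr (h A₀ hA₀)).differentiableWithinAt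

/-- **THE CHARTED BOND VARIABLE IS DIFFERENTIABLE EVERYWHERE AND NEAR `1` ON SMALL `A`**: `‖e^{iηA(b)} − 1‖ ≤ 2·‖ηA(b)‖` when `‖ηA(b)‖ ≤ 1`.
[cite: Balaban1985Variational, (152) p.301] -/
theorem norm_coe_expCfg_sub_one_le (η : ℝ) (A : PBond P 0 → 𝔸) (b : PBond P 0) (h : ‖(η : ℂ) • A b‖ ≤ 1) :
    ‖((expCfg η A b : 𝔸ˣ) : 𝔸) - 1‖ ≤ 2 * ‖(η : ℂ) • A b‖ := by
  rw [coe_expCfg]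
  have hI : ‖(Complex.I * (η : ℂ)) • A b‖ = ‖(η : ℂ) • A b‖ := by
    rw [mul_smul, norm_smul, Complex.norm_I, one_mul]
  have h1 : ‖(Complex.I * (η : ℂ)) • A b‖ ≤ 1 := by rw [hI]; exact h
  calc _ ≤ 2 * ‖(Complex.I * (η : ℂ)) • A b‖ := B7TransferAnalyticMean.norm_exp_sub_one_le_two_mul h1
    _ = 2 * ‖(η : ℂ) • A b‖ := by rw [hI]

end Summit.QuantumFields.YangMills.Theorems.Prop8Chart

end
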